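import Summits.BirchSwinnertonDyer.Rank1Residual.ManinAdditive.CMLatticeSqueeze
import HarnessLib

/-!
# THE SQUEEZE — COROLLARIES 1–7 on the CM bands (es g29 §4; T-es-46 part 2/3; theorem-only)

TYPER NOTE (typer g19, T-es-46, part 2/3).  SOURCE = HOME/es/g29/Sketch-es-g29.lean sha16 6d73975d830cb788 §4 (l. 246–399) VERBATIM except this
note and the namespace (`…ManinAdditive.KatoCurve.CMOptimal`); imports part 1 `CMLatticeSqueeze` (squeeze theorems + the six typed laws).  CONTENT (es):
`isNewformOf_of_isIsogenous` (newform transfer along an isogeny from the tree fact `LFunction_eq_of_isIsogenous`); COR 1 `maninConstant_unit_on_cm1728_band`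
(T2Λ ∧ E-es-133₂ ⟹ `c = ±1` on the `j = 1728` band off 32/64); COR 2 `lattice_eq_twin_on_cm1728_band`; COR 3 `maninConstant_unit_on_cm0_band`; COR 4/5
`not_two_dvd_maninConstant_on_cm1728_band` / `not_three_dvd_maninConstant_on_cm0_band` / `not_two_dvd_maninConstant_on_cm0_band` (local laws ⟹
`2 ∤ c` / `3 ∤ c`); COR 6/7 **`not_two_dvd_maninConstant_on_cmClass_two`** (`CMOptimalIsFullCMTwo → CMPeriodLatticeLawTwoLocal → CMTwinLatticeLeTwo →
LFunction_eq_of_isIsogenous → … → 2² ∣ N → ¬ 2 ∣ c`) = C2 on the whole `ℚ(i)`-CM locus modulo three c-free laws, **`not_three_dvd_maninConstant_on_cmClass_three`**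
= C3 on the `ℚ(√−3)` locus.  All PROVED (kernel-checked implications; hypotheses in, conclusions out); nothing conjectured here.  ref1 §R148: hypothesis
lists audited, SURVIVE.  PARTITION 0 · beyond-print theorem: no · bears_on: stmt-BirchSwinnertonDyer-22967 / 22968.  BSD is not proved by this;
Manin's conjecture is not proved by this; C2/C3 OPEN.
-/

noncomputable section

namespace Summit.BirchSwinnertonDyer.Rank1Residual.ManinAdditive.KatoCurve.CMOptimal

open scoped MatrixGroups ModularForm
open CongruenceSubgroup WeierstrassCurve Literature.NumberTheory.EllipticCurves
  Literature.NumberTheory.EllipticCurves.ModularForms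
  Summit.BirchSwinnertonDyer.Rank1Residual.ManinAdditive.KatoCurve.CMOptimal


/-! ## §4 Corollaries on the CM bands (kernel-checked) -/

section Corollaries

/-- Newform transfer along an isogeny (Faltings: isogenous curves have the same `a_n`; tree fact
`LFunction_eq_of_isIsogenous`). -/
theorem isNewformOf_of_isIsogenous (hL : LFunction_eq_of_isIsogenous)
    {V W : WeierstrassCurve ℚ} [V.IsElliptic] [W.IsElliptic] {N : ℕ} [NeZero N] {f : CuspForm (Gamma0 N) 2}
    (hW : IsNewformOf W f) (hiso : WeierstrassCurve.IsIsogenous V W) : IsNewformOf V f :=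
  ⟨hW.1, fun n => by rw [hL V W hiso]; exact hW.2 n⟩

/-- **COROLLARY 1 (the `j = 1728` band, full squeeze).**  T2Λ ∧ E-es-133₂ (∧ `LFunction_eq_of_isIsogenous`) ⟹ for every
globally minimal `W` of `j = 1728` and every optimal datum `D` (lattice clause), if `W`'s class has its twist-reduced twin
`V` off conductors 32, 64, then `c(D) = ±1` — Manin's conjecture up to sign for these classes (all primes at once: C2, C3
and the `p ≥ 5` residual of `ManinLocalTwoThree` restricted to the regular `ℚ(i)`-CM band). -/
theorem maninConstant_unit_on_cm1728_band
    (hΛ : CMPeriodLatticeLawTwo) (hmin : CMTwinLatticeLeTwo) (hL : LFunction_eq_of_isIsogenous)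
    (W : WeierstrassCurve ℚ) [W.IsElliptic] [W.IsGloballyMinimal] {N : ℕ} [NeZero N]
    (D : ModularParametrizationData W N)
    (hD : ∀ z ∈ D.L.lattice, ∃ w ∈ periodLattice D.f, z = D.c * w)
    (V : WeierstrassCurve ℚ) [V.IsElliptic] [V.IsGloballyMinimal] (LV : PeriodPair)
    (hjV : V.j = 1728) (hjW : W.j = 1728) (hiso : WeierstrassCurve.IsIsogenous V W)
    (hLV : IsNeronLatticeOf (V.baseChange ℂ) LV)
    (hred : ∀ (W' : WeierstrassCurve ℚ) [W'.IsElliptic] [W'.IsGloballyMinimal],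
        W'.j = 1728 → WeierstrassCurve.IsIsogenous V W' → (W'.c₄ = V.c₄ ∨ W'.c₄ = -4 * V.c₄))
    (h32 : V.conductorNorm ℤ ≠ 32) (h64 : V.conductorNorm ℤ ≠ 64) :
    D.maninConstant = 1 ∨ D.maninConstant = -1 :=
  maninConstant_eq_one_or_eq_neg_one_of_cuspSymbol_mem D hD LV.lattice
    (hΛ V D.f LV hjV (isNewformOf_of_isIsogenous hL D.isNewformOf hiso) hLV hred h32 h64)
    (hmin V W LV D.L hjV hjW hiso hLV D.isNeronLattice hred)

/-- **COROLLARY 1′ (`j = 1728`: the optimal lattice is the small twin's lattice).**  Same hypotheses: `Λ(V) = Λ_W` — so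
`W ≅ V` over `ℂ` with matching Néron lattices (the T2c conclusion for `j`-members, obtained from T2Λ ∧ E-es-133₂ alone). -/
theorem lattice_eq_twin_on_cm1728_band
    (hΛ : CMPeriodLatticeLawTwo) (hmin : CMTwinLatticeLeTwo) (hL : LFunction_eq_of_isIsogenous)
    (W : WeierstrassCurve ℚ) [W.IsElliptic] [W.IsGloballyMinimal] {N : ℕ} [NeZero N]
    (D : ModularParametrizationData W N)
    (hD : ∀ z ∈ D.L.lattice, ∃ w ∈ periodLattice D.f, z = D.c * w)
    (V : WeierstrassCurve ℚ) [V.IsElliptic] [V.IsGloballyMinimal] (LV : PeriodPair)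
    (hjV : V.j = 1728) (hjW : W.j = 1728) (hiso : WeierstrassCurve.IsIsogenous V W)
    (hLV : IsNeronLatticeOf (V.baseChange ℂ) LV)
    (hred : ∀ (W' : WeierstrassCurve ℚ) [W'.IsElliptic] [W'.IsGloballyMinimal],
        W'.j = 1728 → WeierstrassCurve.IsIsogenous V W' → (W'.c₄ = V.c₄ ∨ W'.c₄ = -4 * V.c₄))
    (h32 : V.conductorNorm ℤ ≠ 32) (h64 : V.conductorNorm ℤ ≠ 64) :
    LV.lattice = D.L.lattice :=
  lattice_eq_of_cuspSymbol_mem D hD LV.lattice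
    (hΛ V D.f LV hjV (isNewformOf_of_isIsogenous hL D.isNewformOf hiso) hLV hred h32 h64)
    (hmin V W LV D.L hjV hjW hiso hLV D.isNeronLattice hred)

/-- **COROLLARY 2 (the `j = 0` band, full squeeze).**  T3Λ ∧ E-es-133₃ ⟹ `c(D) = ±1` for optimal data of `j = 0` curves
whose twist-reduced twin has conductor `≠ 27`. -/
theorem maninConstant_unit_on_cm0_band
    (hΛ : CMPeriodLatticeLawThree) (hmin : CMTwinLatticeLeThree) (hL : LFunction_eq_of_isIsogenous)
    (W : WeierstrassCurve ℚ) [W.IsElliptic] [W.IsGloballyMinimal] {N : ℕ} [NeZero N]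
    (D : ModularParametrizationData W N)
    (hD : ∀ z ∈ D.L.lattice, ∃ w ∈ periodLattice D.f, z = D.c * w)
    (V : WeierstrassCurve ℚ) [V.IsElliptic] [V.IsGloballyMinimal] (LV : PeriodPair)
    (hjV : V.j = 0) (hjW : W.j = 0) (hiso : WeierstrassCurve.IsIsogenous V W)
    (hLV : IsNeronLatticeOf (V.baseChange ℂ) LV)
    (hred : ∀ (W' : WeierstrassCurve ℚ) [W'.IsElliptic] [W'.IsGloballyMinimal],
        W'.j = 0 → WeierstrassCurve.IsIsogenous V W' → (W'.c₆ = V.c₆ ∨ W'.c₆ = -27 * V.c₆))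
    (h27 : V.conductorNorm ℤ ≠ 27) :
    D.maninConstant = 1 ∨ D.maninConstant = -1 :=
  maninConstant_eq_one_or_eq_neg_one_of_cuspSymbol_mem D hD LV.lattice
    (hΛ V D.f LV hjV (isNewformOf_of_isIsogenous hL D.isNewformOf hiso) hLV hred h27)
    (hmin V W LV D.L hjV hjW hiso hLV D.isNeronLattice hred)

/-- **COROLLARY 3 (C2's literal tail on the `j = 1728` band from the LOCAL law).**  E-es-134₂ ∧ E-es-133₂ ⟹
`4 ∣ N → ¬ 2 ∣ D.maninConstant` for optimal data of `j = 1728` curves off the two unit classes (the `4 ∣ N` binder of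
`ManinOddAtFour` is carried, unused). -/
theorem not_two_dvd_maninConstant_on_cm1728_band
    (hΛ : CMPeriodLatticeLawTwoLocal) (hmin : CMTwinLatticeLeTwo) (hL : LFunction_eq_of_isIsogenous)
    (W : WeierstrassCurve ℚ) [W.IsElliptic] [W.IsGloballyMinimal] {N : ℕ} [NeZero N]
    (D : ModularParametrizationData W N)
    (hD : ∀ z ∈ D.L.lattice, ∃ w ∈ periodLattice D.f, z = D.c * w)
    (V : WeierstrassCurve ℚ) [V.IsElliptic] [V.IsGloballyMinimal] (LV : PeriodPair)
    (hjV : V.j = 1728) (hjW : W.j = 1728) (hiso : WeierstrassCurve.IsIsogenous V W)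
    (hLV : IsNeronLatticeOf (V.baseChange ℂ) LV)
    (hred : ∀ (W' : WeierstrassCurve ℚ) [W'.IsElliptic] [W'.IsGloballyMinimal],
        W'.j = 1728 → WeierstrassCurve.IsIsogenous V W' → (W'.c₄ = V.c₄ ∨ W'.c₄ = -4 * V.c₄))
    (h32 : V.conductorNorm ℤ ≠ 32) (h64 : V.conductorNorm ℤ ≠ 64) :
    2 ^ 2 ∣ N → ¬ (2 : ℤ) ∣ D.maninConstant := fun _ =>
  not_dvd_maninConstant_of_saturated_cuspSymbol_mem D hD Int.prime_two LV.lattice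
    (hmin V W LV D.L hjV hjW hiso hLV D.isNeronLattice hred)
    (hΛ V D.f LV hjV (isNewformOf_of_isIsogenous hL D.isNewformOf hiso) hLV hred h32 h64)

/-- **COROLLARY 4 (C3's literal tail on the `j = 0` band from the LOCAL law).** -/
theorem not_three_dvd_maninConstant_on_cm0_band
    (hΛ : CMPeriodLatticeLawThreeLocal) (hmin : CMTwinLatticeLeThree) (hL : LFunction_eq_of_isIsogenous)
    (W : WeierstrassCurve ℚ) [W.IsElliptic] [W.IsGloballyMinimal] {N : ℕ} [NeZero N]
    (D : ModularParametrizationData W N)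
    (hD : ∀ z ∈ D.L.lattice, ∃ w ∈ periodLattice D.f, z = D.c * w)
    (V : WeierstrassCurve ℚ) [V.IsElliptic] [V.IsGloballyMinimal] (LV : PeriodPair)
    (hjV : V.j = 0) (hjW : W.j = 0) (hiso : WeierstrassCurve.IsIsogenous V W)
    (hLV : IsNeronLatticeOf (V.baseChange ℂ) LV)
    (hred : ∀ (W' : WeierstrassCurve ℚ) [W'.IsElliptic] [W'.IsGloballyMinimal],
        W'.j = 0 → WeierstrassCurve.IsIsogenous V W' → (W'.c₆ = V.c₆ ∨ W'.c₆ = -27 * V.c₆))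
    (h27 : V.conductorNorm ℤ ≠ 27) :
    3 ^ 2 ∣ N → ¬ (3 : ℤ) ∣ D.maninConstant := fun _ =>
  not_dvd_maninConstant_of_saturated_cuspSymbol_mem D hD Int.prime_three LV.lattice
    (hmin V W LV D.L hjV hjW hiso hLV D.isNeronLattice hred)
    (hΛ V D.f LV hjV (isNewformOf_of_isIsogenous hL D.isNewformOf hiso) hLV hred h27)

/-- **COROLLARY 5 (C2 on the `j = 0` band too).**  `j = 0` optimal curves with `4 ∣ N` (e.g. 36a, 144a) are in the
scope of `ManinOddAtFour`; the full squeeze at `j = 0` gives `2 ∤ c` there as well. -/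
theorem not_two_dvd_maninConstant_on_cm0_band
    (hΛ : CMPeriodLatticeLawThree) (hmin : CMTwinLatticeLeThree) (hL : LFunction_eq_of_isIsogenous)
    (W : WeierstrassCurve ℚ) [W.IsElliptic] [W.IsGloballyMinimal] {N : ℕ} [NeZero N]
    (D : ModularParametrizationData W N)
    (hD : ∀ z ∈ D.L.lattice, ∃ w ∈ periodLattice D.f, z = D.c * w)
    (V : WeierstrassCurve ℚ) [V.IsElliptic] [V.IsGloballyMinimal] (LV : PeriodPair)
    (hjV : V.j = 0) (hjW : W.j = 0) (hiso : WeierstrassCurve.IsIsogenous V W)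
    (hLV : IsNeronLatticeOf (V.baseChange ℂ) LV)
    (hred : ∀ (W' : WeierstrassCurve ℚ) [W'.IsElliptic] [W'.IsGloballyMinimal],
        W'.j = 0 → WeierstrassCurve.IsIsogenous V W' → (W'.c₆ = V.c₆ ∨ W'.c₆ = -27 * V.c₆))
    (h27 : V.conductorNorm ℤ ≠ 27) :
    2 ^ 2 ∣ N → ¬ (2 : ℤ) ∣ D.maninConstant := fun _ =>
  not_dvd_of_eq_one_or_eq_neg_one
    (maninConstant_unit_on_cm0_band hΛ hmin hL W D hD V LV hjV hjW hiso hLV hred h27) Int.prime_two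

/-- **COROLLARY 6 (C2 on the whole `ℚ(i)`-CM locus, three laws).**  E-es-135₂ ∧ E-es-134₂ ∧ E-es-133₂ ⟹ for every
globally minimal `W` ISOGENOUS TO SOME `j = 1728` curve and every optimal datum `D` of `W`: `4 ∣ N → 2 ∤ c(D)`, provided the
class's twist-reduced twin `V` (supplied with its Néron pair) is off conductors 32, 64.  (`ManinOddAtFour` restricted to
the `ℚ(i)`-CM locus, modulo three typed c-free laws, one of them — E-es-133₂ — provable now.) -/
theorem not_two_dvd_maninConstant_on_cmClass_two
    (hj : CMOptimalIsFullCMTwo) (hΛ : CMPeriodLatticeLawTwoLocal) (hmin : CMTwinLatticeLeTwo)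
    (hL : LFunction_eq_of_isIsogenous)
    (W : WeierstrassCurve ℚ) [W.IsElliptic] [W.IsGloballyMinimal] {N : ℕ} [NeZero N]
    (D : ModularParametrizationData W N)
    (hD : ∀ z ∈ D.L.lattice, ∃ w ∈ periodLattice D.f, z = D.c * w)
    (V : WeierstrassCurve ℚ) [V.IsElliptic] [V.IsGloballyMinimal] (LV : PeriodPair)
    (hjV : V.j = 1728) (hiso : WeierstrassCurve.IsIsogenous V W)
    (hLV : IsNeronLatticeOf (V.baseChange ℂ) LV)
    (hred : ∀ (W' : WeierstrassCurve ℚ) [W'.IsElliptic] [W'.IsGloballyMinimal],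
        W'.j = 1728 → WeierstrassCurve.IsIsogenous V W' → (W'.c₄ = V.c₄ ∨ W'.c₄ = -4 * V.c₄))
    (h32 : V.conductorNorm ℤ ≠ 32) (h64 : V.conductorNorm ℤ ≠ 64) :
    2 ^ 2 ∣ N → ¬ (2 : ℤ) ∣ D.maninConstant :=
  not_two_dvd_maninConstant_on_cm1728_band hΛ hmin hL W D hD V LV hjV (hj W D hD V hjV hiso) hiso hLV hred h32 h64

/-- **COROLLARY 7 (C3 on the whole `ℚ(√−3)`-CM locus, three laws).** -/
theorem not_three_dvd_maninConstant_on_cmClass_three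
    (hj : CMOptimalIsFullCMThree) (hΛ : CMPeriodLatticeLawThreeLocal) (hmin : CMTwinLatticeLeThree)
    (hL : LFunction_eq_of_isIsogenous)
    (W : WeierstrassCurve ℚ) [W.IsElliptic] [W.IsGloballyMinimal] {N : ℕ} [NeZero N]
    (D : ModularParametrizationData W N)
    (hD : ∀ z ∈ D.L.lattice, ∃ w ∈ periodLattice D.f, z = D.c * w)
    (V : WeierstrassCurve ℚ) [V.IsElliptic] [V.IsGloballyMinimal] (LV : PeriodPair)
    (hjV : V.j = 0) (hiso : WeierstrassCurve.IsIsogenous V W)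
    (hLV : IsNeronLatticeOf (V.baseChange ℂ) LV)
    (hred : ∀ (W' : WeierstrassCurve ℚ) [W'.IsElliptic] [W'.IsGloballyMinimal],
        W'.j = 0 → WeierstrassCurve.IsIsogenous V W' → (W'.c₆ = V.c₆ ∨ W'.c₆ = -27 * V.c₆))
    (h27 : V.conductorNorm ℤ ≠ 27) :
    3 ^ 2 ∣ N → ¬ (3 : ℤ) ∣ D.maninConstant :=
  not_three_dvd_maninConstant_on_cm0_band hΛ hmin hL W D hD V LV hjV (hj W D hD V hjV hiso) hiso hLV hred h27

end Corollaries

end Summit.BirchSwinnertonDyer.Rank1Residual.ManinAdditive.KatoCurve.CMOptimal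

end
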